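import Summits.QuantumFields.BalabanUV.T4Continuum.Spine.NE1p.DressedSmallFieldSlotLettersWitness
import Summits.QuantumFields.BalabanUV.T4Continuum.Support.SubstrateDrivenRecordSU
import Literature.MathematicalPhysics.QuantumFieldTheory.Balaban1983to89.T4WindowLevelShift

/-!
# T⁴ programme, spine estimate NE1′ (node O3b/H2) — WITNESS W58 «THE SLOT-LETTERS END FIRES ON THE TORUS», PART 2: S31 §1's
# `attachedPart_locE_le_of_coreLettersOf_torus` APPLIED ONCE BY NAME at `coreLettersOf (AW D)` for EVERY driven two-run object `D` and
# EVERY run-B background `U`; the activity of record AT THE CENTRE in closed form `e^{V″(h)(Z,0)} − 1` (the normalisation OF RECORD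
# `π^{−1/2}` cancels the Gaussian volume `√π`); (B3) as a letter budget MET by a large (2.18) radius; the bounded quantity NOT zero;
# the schema's parameters INHABITED by the substrate's hypothesis-free driven object of record at `SU(2)`

Cell `pub-balaban`, sub-cell `t4`, row NE1′ formalisation crew (`t4/formal/NE1p/LEAVES.md` row W58 ∕ DAG N29zzzf, BOOKED typer
R-T133 (ii) from OPEN OFFER O-g14; INTENT `CLAIMS.log` l.20840, PROTOTYPE l.20984, STAGED l.21120), unit `b2b-balaban-t4-ne1p-formalise-leaf-04` (LEAF PROVER 04, gen 15).  ADDITIVE — imports PART 1 `Spine/NE1p/DressedSmallFieldSlotLettersWitness`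
(the datum `AW D`, its frame `PW D`, table `tabW D`, S30 §1's conditions `hbase_W`∕`hrdm_W`∕`hrd_W`∕`hctr_W`∕`hbud_W`∕`hmq_W`, the computed letters
`N_ℓW_zero`∕`q_ℓW_zero`; ⇒ S31, S30, W40, W33, W24, the substrate), the substrate's `Support/SubstrateDrivenRecordSU` (p2: `drivenRecordSU`,
`one_mem_domV_drivenRecordSU`) and Literature `T4WindowLevelShift` (`Sanity.F13`) ONLY — all LANDED; toy DATA `def`s + theorems; 0 `def … :
Prop`, 0 cite, 0 sorry; nothing of PART 1's imports restated — used BY NAME.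

WHAT.
* §4 the letters of the core `coreOf (coreLettersOf (AW D))` BY NAME: `lam = lamJ (PEmpty ⊕ Unit)`, `lam(univ) = 2π` (W40's `lam₁_real_univ`),
  `wB = wB₁ rW` (`wB_ofContours`: empty cube product × one polymer), `N₁ = rW·level136 toyConsts (d Z)` (`N₁_ofContours`), `‖τ p‖ = rW`
  (`norm_τ_ofContours`), `chi = 1`, `readOut p v h = circ rW θ_p · V″(h)(Z, 0)`; and **`actOfLetters_zero_closed`**: AT THE CENTRE `o = 0`,
  `actOfLetters (PW D) ℂ … (coreLettersOf … (AW D)) Z j 0 h = e^{V″(h)(Z,0)} − 1` — the inner Gaussian `∫ e^{−‖v‖²} = √π` (W33 `gaussian_E1`) times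
  the normalisation OF RECORD `N 0 a = π^{−1∕2}` is EXACTLY `1` (it is the Gaussian's own normalisation — not a chosen constant as in W40), the
  one-index `Measure.pi` collapses to `lam₁` (`measurePreserving_funUnique`), and row NE5's `integral_w₁_mul_eq_sub` (Cauchy + FTC) ONCE;
* §5 on pv22's periodic carrier `tsys 4 N`: (B1b)'s residue DECIDED (`termsW`: ONE factor `(Z₀ D, ())` on W24's one-cube `X₀`), the dressing
  `wW D := sW • tabW D` (`sW := 1∕(2rW)`), the summed slot activity `actSW` (LITERALLY the function the END bounds), `hsmall_W` (S31's located
  numerals: `A·e·K₀(64,8)·9·64 = 1`), **`letterMass_le`** — the ONE factor's letter mass `2π · wB₁ rW · (2π)^{−1∕2}√(max 1 (1!·2+2)) · (π∕(mq∕2))^{1∕2}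
  · e^{rW·2‖wW‖} ≤ 9·rW∕(rW−1)² ≤ 32∕rW = A` at the PROVED margin `mq = 1∕2` (`nlinarith` from `rW ≥ 32`) —, **`hM3_W`** ((B3) in S31 §1's literal
  letter-budget shape, MET at `X₀`; decay factor `1` since `d(X₀) = 0`), and **`slotLettersEnd_fires_torus D N U k`** = S31 §1
  `attachedPart_locE_le_of_coreLettersOf_torus D (PW D) ℂ (𝒵W D) (domW D) (JcW D) (VW D) (mIW D) (AW D) …` APPLIED ONCE BY NAME — every binder a
  named lemma of PART 1 ∕ this file or a one-line arithmetic term (`W := univ`, `ctr := ctrW`, `ROp := 1∕2 < R′ := 1`, `RHist := 2`,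
  `(β₀, ϑ, d₀, γ) := (2, ϑW, 2, 2)`, `g := 0`, `o := 0`, `h₀ := 0`, `w := wW D`, `ϱ := 2`, `emb Z := D.mkDom k (singleDom 0)` with `hscale` by
  `rfl`, `(A₀, A₁, R, r₁) := (0, A∕2, 2·(64·log 162) + 2, 0)`); conclusion LITERAL; `slotLettersEnd_fires_torus_closed`: the bound in closed form `4·(e·9·64·K₀(64,8)²)·(A∕2)·1 = 2·K₀(64,8)`;
* §6 GENUINE: `actSW_dressed : actSW D N (0 + wW D) (X₀ N) = e^{sW} − 1`, `actSW_undressed = 0` (`F 1 − F 0` of a constant `F`), `actSW_live`,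
  **`slotLettersEnd_live`** — the END's bounded `locE` difference is NOT zero (W24 `exp_locE_cube` BY NAME; the `Dom`-pinned statement of
  S31's currency accepts W24's classical-cone lemma by type ascription, no cast — typer R-T123 (vii));
* §7 THE SCHEMA's PARAMETERS INHABITED HYPOTHESIS-FREE: `DW := drivenRecordSU (n := Fin 2) F13 0 0 1 1` (substrate p2: the driven two-run
  object OF RECORD at `SU(2)`, `1 ∈ domV` with no displayed hypothesis), `UW := DW.uB ⟨1, one_mem_domV_drivenRecordSU …⟩`, and the two
  corollaries `slotLettersEnd_fires_torus_SU2`, `slotLettersEnd_live_SU2`.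

HONEST FRAMING (typer R-T132 (ii) wording + rider ADOPTED).  A DECIDED TOY ([folklore]; 0 sorry; 0 citations; no `def … : Prop`): S31 §1's
END applied once BY NAME to ONE `ActLetters` datum over the substrate's FORMAT and p3's PROVED Gaussian letters, for every driven two-run
object — including whichever the cell finally instantiates — because the toy's letters do not read `D` beyond its carrier index and
frame TYPES; the LIVE object is OUR decided contour∕table∕Gaussian datum evaluated by Mathlib's Gaussian integral and Cauchy formula
through row NE5's lemma — NOT Bałaban's (2.14) representation of a resummed activity, whose identification (B1b) is NOT claimed; (B3)'s
letter-mass clause holds BY CHOICE of the radius `rW` — (B3) = G-ne9p2-5 stays UNPRINTED for Bałaban's cores; `rW = 32∕A`, `sW`, `2π`, `√π`,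
`e^{sW} − 1` are OUR toy arithmetic in W33's located `A` — k2: no numeral of [Balaban1988RGII] asserted; `F13`∕`SU(2)`∕`K = 0`∕unit couplings
are the free letters of the substrate's object of record, chosen here only to show the parameter set non-empty; 0 binders instantiated on
Bałaban's densities; no wall item; wall v1.7 (T4-DAG v47) does NOT move; R-t4r2-Q2 NOT met thereby; NE1′ ⇐ the named binders — NOT proved,
NOT printed; spine PROVED 0∕9; count 9 unchanged.  Rung (B)+1 on ONE finite four-torus — NOT infinite volume, NOT a mass gap, NOT OS on ℝ⁴,
NOT Clay.  HONEST DEPENDENCY: continuum YM on T⁴ ⇐ BetaPertH ∧ nine spine estimates (0/9 proved); BetaPertH ⇐ (D1) ∧ (D4) ∧ CAP+tail;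
G-an2-4 gates asym, D1 and NE2/3/4.
-/

noncomputable section

namespace Summit.QuantumFields.BalabanUV.T4Continuum.NE1p.DressedSmallFieldSlotLettersWitnessEnd

open Set Metric MeasureTheory Complex
open scoped BigOperators Matrix
open Literature.MathematicalPhysics.QuantumFieldTheory.Balaban1983to89
open Literature.MathematicalPhysics.QuantumFieldTheory.Balaban1983to89.B12TreeDecay (K₀ K₀_pos)
open Literature.MathematicalPhysics.QuantumFieldTheory.Balaban1983to89.B13Resummation (locE)
open Literature.MathematicalPhysics.QuantumFieldTheory.Balaban1983to89.TreeLengthTorus (TDom tsys torusTreeLen torusTreeLen_singleton)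
open Literature.MathematicalPhysics.QuantumFieldTheory.Balaban1983to89.TreeLengthTorusGeometry (tgeometry TTouch)
open Literature.MathematicalPhysics.QuantumFieldTheory.Balaban1983to89.T4WindowLevelShift.Sanity (F13)
open Summit.QuantumFields.BalabanUV.T4Continuum.B13HistDatum (level136)
open Summit.QuantumFields.BalabanUV.T4Continuum.B13HistMeasurable (MeasPotFrame B13HistM)
open Summit.QuantumFields.BalabanUV.T4Continuum.B13HistReadout (VppCLMM VppCLMM_apply)
open Summit.QuantumFields.BalabanUV.T4Continuum.B13HistWitness (toyConsts toy_posUnits level136_toy)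
open Summit.QuantumFields.BalabanUV.T4Continuum.B13Carriers (TwoRuns singleDom singleDom_val)
open Summit.QuantumFields.BalabanUV.T4Continuum.B13TermParamGaussianBi (BiCore)
open Summit.QuantumFields.BalabanUV.T4Continuum.B13TermContours (lam₁ w₁ wB₁ circ lamJ wJ wBJ radii sigmaJ integral_w₁_mul_eq_sub)
open Summit.QuantumFields.BalabanUV.T4Continuum.B13TermContourCore (ofContours wB_ofContours N₁_ofContours norm_τ_ofContours)
open Summit.QuantumFields.BalabanUV.T4Continuum.SubstrateTwoRunsDriven (DrivenRuns)
open Summit.QuantumFields.BalabanUV.T4Continuum.SubstrateBlockAvgContinuity (drivenRecordSU one_mem_domV_drivenRecordSU)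
open Summit.QuantumFields.BalabanUV.T4Continuum.SubstrateActivities (CoreLetters coreOf actOfLetters actOfLetters_apply)
open Summit.QuantumFields.BalabanUV.T4Continuum.SubstrateGaussianLetters (gaussC)
open Summit.QuantumFields.BalabanUV.T4Continuum.SubstrateSlotsOfRecord (ActLetters coreLettersOf)
open Summit.QuantumFields.BalabanUV.T4Continuum.NE1p.DressedSmallFieldOnCoresSlotLettersTorus (attachedPart_locE_le_of_coreLettersOf_torus)
open Summit.QuantumFields.BalabanUV.T4Continuum.NE1p.DressedSmallFieldCoresWitness (E1 Acst Acst_pos gaussian_E1)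
open Summit.QuantumFields.BalabanUV.T4Continuum.NE1p.DressedSmallFieldTorusWitness (X₀ X₀_val eq_X₀_iff hrate_torus_num exp_locE_cube)
open Summit.QuantumFields.BalabanUV.T4Continuum.NE1p.DressedSmallFieldSlotWitness (instUniqueIdx lam₁_real_univ)
open Summit.QuantumFields.BalabanUV.T4Continuum.NE1p.DressedSmallFieldSlotLettersWitness

variable {G : Type} [GaugeGroup G] (D : DrivenRuns G)

/-! ## §4 The letters of the core `coreOf (coreLettersOf (AW D))` BY NAME, and the activity of record AT THE CENTRE in closed form -/

section Core
variable (Z : D.carriers.Dom) (j : Unit)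

/-- The parameter measure IS row NE5's `lamJ` on the one-variable index (`rfl`). [folklore] -/
theorem lam_core : (coreOf (PW D) ℂ (𝒵W D) (domW D) (JcW D) (VW D) (ℓW D) Z j).lam = lamJ (PEmpty.{1} ⊕ Unit) := rfl
/-- **THE PARAMETER VOLUME** `lam(univ) = 2π` (ONE contour variable; W40's `lam₁_real_univ` BY NAME). [folklore] -/
theorem lam_real_univ : (coreOf (PW D) ℂ (𝒵W D) (domW D) (JcW D) (VW D) (ℓW D) Z j).lam.real univ = 2 * Real.pi := by
  letI := instUniqueIdx
  rw [lam_core]; unfold Measure.real; rw [lamJ, Measure.pi_univ, Fintype.prod_unique]; exact lam₁_real_univ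
/-- **THE WEIGHT LETTER** `wB = wB₁ rW = (2π)⁻¹·((rW − 1)²)⁻¹·rW` (`wB_ofContours` BY NAME: empty cube product × one polymer factor). [folklore] -/
theorem wB_core : (coreOf (PW D) ℂ (𝒵W D) (domW D) (JcW D) (VW D) (ℓW D) Z j).wB = wB₁ rW := by
  unfold coreOf; rw [wB_ofContours, Fintype.prod_empty, one_mul, Fintype.prod_unique]; rfl
/-- **THE READ-OUT LETTER** `N₁ = rW·level136 (d Z)` (`N₁_ofContours` BY NAME). [folklore] -/
theorem N₁_core : (coreOf (PW D) ℂ (𝒵W D) (domW D) (JcW D) (VW D) (ℓW D) Z j).N₁ = rW * level136 toyConsts (D.carriers.d Z) := by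
  unfold coreOf; rw [N₁_ofContours, Fintype.sum_unique]; rfl
/-- The contour weight LIVES ON THE CIRCLE `|τ| = rW` (`norm_τ_ofContours` BY NAME). [folklore] -/
theorem norm_τ_core (p : (PEmpty.{1} ⊕ Unit) → ℝ × ℝ) : ‖(coreOf (PW D) ℂ (𝒵W D) (domW D) (JcW D) (VW D) (ℓW D) Z j).τ p ()‖ = rW :=
  norm_τ_ofContours _ _ _ _ _ _ _ _ p ()
/-- No χ-constraints: the potential-free factor is `1`. [folklore] -/
theorem chi_core (v : E1) : (coreOf (PW D) ℂ (𝒵W D) (domW D) (JcW D) (VW D) (ℓW D) Z j).chi v = 1 := by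
  unfold BiCore.chi BiCore.chiSet; simp [coreOf, ofContours, coreLettersOf, AW]
/-- **THE READ-OUT READS THE TABLE AT THE POLYMER's DOMAIN THROUGH THE CONTOUR**: `readOut p v h = circ rW θ_p · V″(h)(Z, 0)`. [folklore] -/
theorem readOut_core (p : (PEmpty.{1} ⊕ Unit) → ℝ × ℝ) (v : E1) (h : B13HistM (PW D)) :
    (coreOf (PW D) ℂ (𝒵W D) (domW D) (JcW D) (VW D) (ℓW D) Z j).readOut p v h = circ rW (p (Sum.inr ())).2 * (PW D).VppM h Z (fun _ => (0 : ℝ)) := by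
  rw [BiCore.readOut_apply]
  show ∑ Y ∈ (Finset.univ : Finset Unit), sigmaJ (radii (Jc := PEmpty.{1}) (1 : ℝ) (fun _ : Unit => rW)) p (Sum.inr Y) * _ = _
  rw [Finset.univ_unique, Finset.sum_singleton]
  rfl
/-- The fluctuation integral AT THE CENTRE is the Gaussian volume: `∫ chi·e^{x}·e^{−q(0,p,v)} dv = e^{x}·√π` (W33's `gaussian_E1`). [folklore] -/
theorem inner_core_zero (x : ℂ) (p : (PEmpty.{1} ⊕ Unit) → ℝ × ℝ) :
    ∫ v : E1, (coreOf (PW D) ℂ (𝒵W D) (domW D) (JcW D) (VW D) (ℓW D) Z j).chi v * cexp x *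
        cexp (-(coreOf (PW D) ℂ (𝒵W D) (domW D) (JcW D) (VW D) (ℓW D) Z j).q 0 p v) = cexp x * (Real.sqrt Real.pi : ℂ) := by
  simp_rw [chi_core, one_mul]
  have hq : ∀ v : E1, (coreOf (PW D) ℂ (𝒵W D) (domW D) (JcW D) (VW D) (ℓW D) Z j).q 0 p v = ((‖v‖ ^ 2 : ℝ) : ℂ) := fun v => (q_ℓW_zero D) Z j p v
  simp_rw [hq]
  rw [integral_const_mul]
  congr 1
  have h : ∀ v : E1, cexp (-(((‖v‖ ^ 2 : ℝ) : ℂ))) = ((Real.exp (-‖v‖ ^ 2) : ℝ) : ℂ) := fun v => by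
    rw [← Complex.ofReal_neg, ← Complex.ofReal_exp]
  simp_rw [h]
  rw [integral_complex_ofReal, gaussian_E1]
/-- The product Cauchy weight over the one-variable index IS the one-variable weight at radius `rW`. [folklore] -/
theorem wJ_core (p : (PEmpty.{1} ⊕ Unit) → ℝ × ℝ) :
    wJ (radii (Jc := PEmpty.{1}) (1 : ℝ) (fun _ : Unit => rW)) p = w₁ rW (p (Sum.inr ())) := by
  letI := instUniqueIdx; unfold wJ; rw [Fintype.prod_unique]; rfl
/-- **THE ACTIVITY OF RECORD AT THE CENTRE IN CLOSED FORM** [decided toy]: `actOfLetters (coreLettersOf (AW D)) Z j 0 h = e^{V″(h)(Z,0)} − 1` —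
the normalisation of record `π^{−1/2}` CANCELS the Gaussian volume `√π` EXACTLY (it is the Gaussian's normalisation, not a chosen
constant), the one-index `Measure.pi` collapses to `lam₁`, and row NE5's `integral_w₁_mul_eq_sub` (Cauchy + FTC) evaluates the contour
integral at the entire `F τ := e^{τ·V″(h)(Z,0)}`. [folklore] -/
theorem actOfLetters_zero_closed (h : B13HistM (PW D)) :
    actOfLetters (PW D) ℂ (𝒵W D) (domW D) (JcW D) (VW D) (ℓW D) Z j 0 h = cexp ((PW D).VppM h Z (fun _ => (0 : ℝ))) - 1 := by
  letI := instUniqueIdx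
  rw [actOfLetters_apply]
  set c : ℂ := (PW D).VppM h Z (fun _ => (0 : ℝ)) with hc
  unfold BiCore.termAt
  simp_rw [readOut_core, inner_core_zero]
  have hN : ∀ p, (coreOf (PW D) ℂ (𝒵W D) (domW D) (JcW D) (VW D) (ℓW D) Z j).N 0 p = (((Real.sqrt Real.pi)⁻¹ : ℝ) : ℂ) := fun p => (N_ℓW_zero D) Z j p
  simp_rw [hN]
  show ∫ p, wJ (radii (Jc := PEmpty.{1}) (1 : ℝ) (fun _ : Unit => rW)) p * (((Real.sqrt Real.pi)⁻¹ : ℝ) : ℂ) *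
      (cexp (circ rW (p (Sum.inr ())).2 * c) * (Real.sqrt Real.pi : ℂ)) ∂(lamJ (PEmpty.{1} ⊕ Unit)) = _
  have hπ : (Real.sqrt Real.pi : ℂ) ≠ 0 := by exact_mod_cast (Real.sqrt_pos.2 Real.pi_pos).ne'
  have hsimp : ∀ p : (PEmpty.{1} ⊕ Unit) → ℝ × ℝ, wJ (radii (Jc := PEmpty.{1}) (1 : ℝ) (fun _ : Unit => rW)) p *
      (((Real.sqrt Real.pi)⁻¹ : ℝ) : ℂ) * (cexp (circ rW (p (Sum.inr ())).2 * c) * (Real.sqrt Real.pi : ℂ)) =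
      w₁ rW (p (Sum.inr ())) * cexp (circ rW (p (Sum.inr ())).2 * c) := fun p => by
    rw [wJ_core, Complex.ofReal_inv]; field_simp
  simp_rw [hsimp]
  have hmp := measurePreserving_funUnique lam₁ (PEmpty.{1} ⊕ Unit)
  have key : ∫ p, w₁ rW (p (Sum.inr ())) * cexp (circ rW (p (Sum.inr ())).2 * c) ∂(lamJ (PEmpty.{1} ⊕ Unit)) =
      ∫ y, w₁ rW y * cexp (circ rW y.2 * c) ∂lam₁ :=
    hmp.integral_comp' (fun y : ℝ × ℝ => w₁ rW y * cexp (circ rW y.2 * c))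
  rw [key]
  have hF : DifferentiableOn ℂ (fun τ : ℂ => cexp (τ * c)) univ := by
    apply Differentiable.differentiableOn; fun_prop
  rw [integral_w₁_mul_eq_sub (r := rW) one_lt_rW isOpen_univ (subset_univ _) hF]
  simp only [one_mul, zero_mul, Complex.exp_zero]

end Core


/-! ## §5 The slot activities on the periodic carrier `tsys 4 N` (toy DATA), (B3) as a letter budget MET, and THE END FIRES -/

section Torus
variable (N : ℕ) [NeZero N]

open Classical in
/-- (B1b)'s residue, DECIDED: ONE factor `((Z₀ D), ())` on W24's one-cube domain `X₀`, none elsewhere (toy DATA). [folklore] -/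
def termsW (Z : TDom 4 N) : Finset (D.carriers.Dom × Unit) := if Z.1 = {0} then {((Z₀ D), ())} else ∅
/-- On `X₀` there is exactly the one factor. [folklore] -/
theorem termsW_X₀ : (termsW D) N (X₀ N) = {((Z₀ D), ())} := by unfold termsW; rw [if_pos (X₀_val N)]
/-- THE PENCIL LENGTH `sW := 1/(2·rW)` of the dressing (so that the table growth `e^{N₁·ϱ‖w‖} ≤ e`). [folklore] -/
def sW : ℝ := 1 / (2 * rW)
/-- `0 < sW`. [folklore] -/
theorem sW_pos : 0 < sW := by unfold sW; have := one_lt_rW; positivity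
/-- `sW ≤ 1/64` (`rW ≥ 32`). [folklore] -/
theorem sW_le : sW ≤ 1 / 64 := by
  unfold sW; rw [div_le_div_iff₀ (by linarith [one_lt_rW]) (by norm_num)]; linarith [rW_ge]
/-- THE DRESSING `(wW D) := sW • (tabW D)` (toy DATA). [folklore] -/
def wW : B13HistM (PW D) := (sW : ℂ) • (tabW D)
/-- `‖wW‖ ≤ sW` (the table lies in the unit ball). [folklore] -/
theorem norm_wW_le : ‖(wW D)‖ ≤ sW := by
  unfold wW; rw [norm_smul, Complex.norm_real, Real.norm_eq_abs, abs_of_pos sW_pos]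
  exact (mul_le_mul_of_nonneg_left (norm_tabW_le D) sW_pos.le).trans (le_of_eq (mul_one _))
/-- THE SUMMED SLOT ACTIVITY at operator datum `0` and table `h` (toy DATA) — LITERALLY the function S31 §1's END bounds:
`Z ↦ Σ_{p ∈ (termsW D) Z} actOfLetters … (coreLettersOf … (AW D)) p.1 p.2 0 h`. [folklore] -/
def actSW (h : B13HistM (PW D)) (Z : TDom 4 N) : ℂ := ∑ p ∈ (termsW D) N Z, actOfLetters (PW D) ℂ (𝒵W D) (domW D) (JcW D) (VW D) (ℓW D) p.1 p.2 (0 : ℂ) h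
/-- `hsmall` in S31's located numerals: `(A₀ + ϱA₁)·e^{5r₁+1}·K₀(64,8)·9·64 = A·e·K₀(64,8)·9·64 = 1 ≤ 1` (W33's `Acst` unfolded). [folklore] -/
theorem hsmall_W : (0 + 2 * (Acst / 2)) * Real.exp (5 * 0 + 1) * K₀ 64 8 * 9 * 64 ≤ 1 := by
  rw [show (0 : ℝ) + 2 * (Acst / 2) = Acst by ring, show (5 : ℝ) * 0 + 1 = 1 by norm_num]
  unfold Acst
  have hK := K₀_pos (64 : ℝ) 8
  have he := Real.exp_pos 1
  rw [show (Real.exp 1 * K₀ 64 8 * 9 * 64)⁻¹ * Real.exp 1 * K₀ 64 8 * 9 * 64 = 1 by field_simp]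

/-- **THE ONE FACTOR's LETTER MASS PAYS (B3)** (arithmetic in W33's located `A`; margin stated): parameter volume `2π` × Cauchy weight
`(2π)⁻¹((rW−1)²)⁻¹rW` × normalisation bound `(2π)^{−1/2}·√(max 1 (1!·2 + 2)) = 2/√(2π)` × Gaussian volume at the PROVED margin
`(π/(mq/2))^{1/2} = 2√π` (`mq = 1/2`) × table growth `e^{rW·2‖(wW D)‖} ≤ e` is `≤ 9·rW/(rW−1)² ≤ 32/rW = A`. [folklore] -/
theorem letterMass_le :
    2 * Real.pi * (wB₁ rW * ((Real.sqrt (2 * Real.pi))⁻¹ ^ 1 * Real.sqrt (max 1 (1 * 2 ^ 1 + 2))) * Real.exp 0) *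
        (Real.pi / ((2 - 1 * ϑW * 1) / 2 / 2)) ^ ((1 : ℝ) / 2) * Real.exp (rW * (0 + 2 * ‖(wW D)‖)) ≤ 0 + 2 * (Acst / 2) := by
  have hπ := Real.pi_pos
  have hr := rW_ge
  have hr1 : (0 : ℝ) < (rW - 1) ^ 2 := by nlinarith
  have hs2 : (0 : ℝ) < Real.sqrt (2 * Real.pi) := Real.sqrt_pos.2 (by positivity)
  have hsp : (0 : ℝ) < Real.sqrt Real.pi := Real.sqrt_pos.2 hπ
  have h4 : Real.sqrt (max 1 (1 * 2 ^ 1 + 2)) = 2 := by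
    rw [show (max 1 (1 * 2 ^ 1 + 2) : ℝ) = 2 ^ 2 by norm_num, Real.sqrt_sq (by norm_num)]
  have hϑ : Real.pi / ((2 - 1 * ϑW * 1) / 2 / 2) = (2 * Real.sqrt Real.pi) ^ 2 := by rw [ϑW, mul_pow, Real.sq_sqrt hπ.le]; ring
  have hA : 0 + 2 * (Acst / 2) = 32 / rW := by unfold rW; have := Acst_pos; field_simp; ring
  rw [h4, hϑ, ← Real.sqrt_eq_rpow, Real.sqrt_sq (by positivity), pow_one, Real.exp_zero, mul_one, zero_add, hA]
  have hexp : Real.exp (rW * (2 * ‖(wW D)‖)) ≤ 3 := by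
    have h1 : rW * (2 * ‖(wW D)‖) ≤ 1 := by
      have hw := (norm_wW_le D)
      have : rW * (2 * sW) = 1 := by unfold sW; field_simp
      nlinarith [norm_nonneg (wW D)]
    exact (Real.exp_le_exp.2 h1).trans (le_of_lt (Real.exp_one_lt_d9.trans (by norm_num)))
  have hsq : (Real.sqrt (2 * Real.pi))⁻¹ * 2 * (2 * Real.sqrt Real.pi) ≤ 3 := by
    rw [Real.sqrt_mul' _ hπ.le]
    have h2 : Real.sqrt 2 ≤ 3 / 2 := by
      rw [show (3 / 2 : ℝ) = Real.sqrt ((3 / 2) ^ 2) by rw [Real.sqrt_sq (by norm_num)]]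
      exact Real.sqrt_le_sqrt (by norm_num)
    have h2' : 0 < Real.sqrt 2 := Real.sqrt_pos.2 (by norm_num)
    have hss : Real.sqrt 2 * Real.sqrt 2 = 2 := Real.mul_self_sqrt (by norm_num)
    rw [show (Real.sqrt 2 * Real.sqrt Real.pi)⁻¹ * 2 * (2 * Real.sqrt Real.pi) = 4 / Real.sqrt 2 by field_simp; ring,
      div_le_iff₀ h2']
    nlinarith
  calc 2 * Real.pi * ((2 * Real.pi)⁻¹ * ((rW - 1) ^ 2)⁻¹ * rW * ((Real.sqrt (2 * Real.pi))⁻¹ * 2)) * (2 * Real.sqrt Real.pi) *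
        Real.exp (rW * (2 * ‖(wW D)‖))
      = rW / (rW - 1) ^ 2 * ((Real.sqrt (2 * Real.pi))⁻¹ * 2 * (2 * Real.sqrt Real.pi)) * Real.exp (rW * (2 * ‖(wW D)‖)) := by
        field_simp
    _ ≤ rW / (rW - 1) ^ 2 * 3 * 3 := by
        rw [mul_assoc (rW / (rW - 1) ^ 2), mul_assoc (rW / (rW - 1) ^ 2)]
        exact mul_le_mul_of_nonneg_left (mul_le_mul hsq hexp (Real.exp_pos _).le (by norm_num)) (by positivity)
    _ ≤ 32 / rW := by
        rw [div_mul_eq_mul_div, div_mul_eq_mul_div, div_le_div_iff₀ hr1 (by linarith)]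
        nlinarith [mul_nonneg (by linarith : (0 : ℝ) ≤ rW - 32) (by linarith : (0 : ℝ) ≤ rW)]

/-- **(B3) AS A LETTER BUDGET `hM3` — MET AT `X₀`** [decided toy]: a torus domain inside `X₀` IS `X₀` (W24 `eq_X₀_iff`); there the one
factor's letter mass (`(letterMass_le D)`) is `≤ A = A₀ + ϱA₁` (`A₀ := 0`, `A₁ := A/2`, `ϱ := 2`; decay factor `1` since `d(X₀) = 0`). [folklore] -/
theorem hM3_W (k : ℕ) : ∀ Z : (tsys 4 N).Dom, Z.1 ⊆ (X₀ N).1 →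
    ∑ p ∈ (termsW D) N Z, (coreOf (PW D) ℂ (𝒵W D) (domW D) (JcW D) (VW D) (ℓW D) p.1 p.2).lam.real univ *
        ((coreOf (PW D) ℂ (𝒵W D) (domW D) (JcW D) (VW D) (ℓW D) p.1 p.2).wB *
            (gaussC ((mIW D) p.1 p.2) * Real.sqrt (max 1 ((Fintype.card ((mIW D) p.1 p.2)).factorial *
              (fun (_ : D.carriers.Dom) (_ : Unit) => (2 : ℝ)) p.1 p.2 ^ Fintype.card ((mIW D) p.1 p.2) +
              (fun (_ : D.carriers.Dom) (_ : Unit) => (2 : ℝ)) p.1 p.2))) * Real.exp 0) *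
        (Real.pi / (((fun (_ : D.carriers.Dom) (_ : Unit) => (2 : ℝ)) p.1 p.2 -
          Fintype.card ((mIW D) p.1 p.2) * (fun (_ : D.carriers.Dom) (_ : Unit) => ϑW) p.1 p.2 * (fun _ : ℕ => (1 : ℝ)) k) / 2 / 2)) ^
          (Module.finrank ℝ ((VW D) p.1 p.2) / 2 : ℝ) *
        Real.exp ((coreOf (PW D) ℂ (𝒵W D) (domW D) (JcW D) (VW D) (ℓW D) p.1 p.2).N₁ * (‖(0 : B13HistM (PW D))‖ + 2 * ‖(wW D)‖)) ≤
      (0 + 2 * (Acst / 2)) * Real.exp (-((2 * (64 * Real.log 162) + 2) * torusTreeLen Z.1)) := by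
  intro Z hZ
  have hZX : Z = X₀ N := (eq_X₀_iff N Z).1 ((Finset.Nonempty.subset_singleton_iff Z.2.1).1 hZ)
  subst hZX
  rw [termsW_X₀, Finset.sum_singleton]
  simp only []
  rw [lam_real_univ, wB_core, N₁_core, d_Z₀, level136_toy, mul_one, norm_zero, finrank_euclideanSpace, Fintype.card_fin, Nat.cast_one,
    Nat.factorial_one, Nat.cast_one, one_mul]
  have hd : torusTreeLen (X₀ N).1 = 0 := by rw [X₀_val]; exact torusTreeLen_singleton 0
  rw [hd, mul_zero, neg_zero, Real.exp_zero]
  unfold gaussC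
  rw [Fintype.card_fin]
  have h := (letterMass_le D)
  simp only [wB₁, mul_one, one_mul, zero_add, pow_one, Real.exp_zero] at h ⊢
  exact h

open Classical in
/-- **S31 §1's SLOT-LETTERS END FIRES ON THE TORUS, FOR EVERY DRIVEN TWO-RUN OBJECT `D` AND EVERY RUN-B BACKGROUND `U`** [decided toy]:
`attachedPart_locE_le_of_coreLettersOf_torus D (PW D) ℂ (𝒵W D) (domW D) (JcW D) (VW D) (mIW D) (AW D)` APPLIED ONCE BY NAME with
`W := univ`, centres `ctrW`, radii `ROp := 1∕2 < R′ := 1`, `RHist := 2`, letters `(β₀, ϑ, d₀, γ) := (2, ϑW, 2, 2)`, S30 §1's conditions by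
PART 1's `hbase_W`∕`hrdm_W`∕`hrd_W`∕`hctr_W`∕`hbud_W`∕`hmq_W`, `g := 0`, `o := 0`, `h₀ := 0`, `w := wW D`, `ϱ := 2`, `emb Z := D.mkDom k
(singleDom 0)` (`hscale` by `rfl`), `terms := termsW D N`, `(A₀, A₁, R, r₁) := (0, A∕2, 2·(64·log 162) + 2, 0)`, W24's `hrate_torus_num`,
`hsmall_W`, `hM3_W`, `hϱ : 2 ≤ 2`, `hϱA`.  Conclusion LITERAL (`actSW D N h` IS `fun Z => Σ_{p ∈ termsW D N Z} actOfLetters … p.1 p.2 0 h`).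
Nothing of Bałaban's densities. [folklore] -/
theorem slotLettersEnd_fires_torus (U : D.carriers.BgB) (k : ℕ) :
    ‖locE (Dom := (tsys 4 N).Dom) (TTouch (d := 4) (N := N)) (fun Z : (tsys 4 N).Dom => Z.1) ((actSW D) N ((0 : B13HistM (PW D)) + (wW D))) (X₀ N).1 -
        locE (Dom := (tsys 4 N).Dom) (TTouch (d := 4) (N := N)) (fun Z : (tsys 4 N).Dom => Z.1) ((actSW D) N 0) (X₀ N).1‖ ≤
      4 * (Real.exp 1 * 9 * 64 * K₀ 64 8 ^ 2) * (Acst / 2) * Real.exp (-(0 * torusTreeLen (X₀ N).1)) := by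
  refine attachedPart_locE_le_of_coreLettersOf_torus D (PW D) ℂ (𝒵W D) (domW D) (JcW D) (VW D) (mIW D) (AW D)
    (W := Set.univ) (ctr := (ctrW D)) (ROp := fun _ => 1 / 2) (RHist := fun _ => 2) (R' := fun _ => 1)
    (β₀ := fun _ _ => 2) (ϑ := fun _ _ => ϑW) (d₀ := fun _ _ => 2) (γ := fun _ _ => 2)
    (fun _ => by norm_num) (fun _ => zero_le_one) (hbase_W D) (hrdm_W D) (fun _ _ => by norm_num) (fun _ _ => by norm_num) (hrd_W D) (hctr_W D) (hbud_W D) (hmq_W D)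
    (k := k) (g := fun _ => 0) (Set.mem_univ _) (U := U) (o := 0) (h₀ := 0) (w := (wW D)) (ϱ := 2)
    (by show ‖(0 : ℂ) - 0‖ ≤ 1 / 2; simp)
    (by show ‖(0 : B13HistM (PW D)) - 0‖ + 2 * ‖(wW D)‖ ≤ 2; rw [sub_zero, norm_zero, zero_add]; linarith [(norm_wW_le D), sW_le])
    (emb := fun _ => D.mkDom k (singleDom 0)) (fun _ => rfl) ((termsW D) N)
    (A₀ := 0) (A₁ := Acst / 2) (R := 2 * (64 * Real.log 162) + 2) (r₁ := 0) (X₀ N)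
    le_rfl (by have := Acst_pos; positivity) le_rfl hrate_torus_num hsmall_W ((hM3_W D) N k) le_rfl (by have := Acst_pos; linarith)


open Classical in
/-- … in CLOSED FORM: `≤ 4·(e·9·64·K₀(64,8)²)·(A∕2)·1 = 2·K₀(64,8)` (W33's `Acst` unfolded; the decay factor is `1` on the one cube). [folklore] -/
theorem slotLettersEnd_fires_torus_closed (U : D.carriers.BgB) (k : ℕ) :
    ‖locE (Dom := (tsys 4 N).Dom) (TTouch (d := 4) (N := N)) (fun Z : (tsys 4 N).Dom => Z.1) ((actSW D) N ((0 : B13HistM (PW D)) + (wW D)))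
          (X₀ N).1 -
        locE (Dom := (tsys 4 N).Dom) (TTouch (d := 4) (N := N)) (fun Z : (tsys 4 N).Dom => Z.1) ((actSW D) N 0) (X₀ N).1‖ ≤ 2 * K₀ 64 8 := by
  refine ((slotLettersEnd_fires_torus D) N U k).trans (le_of_eq ?_)
  rw [zero_mul, neg_zero, Real.exp_zero, mul_one]
  unfold Acst
  have hK := K₀_pos (64 : ℝ) 8
  have he := Real.exp_pos 1
  field_simp
  ring

/-! ## §6 GENUINE: the attached part of the slot activity at `X₀` is `e^{sW} − 1 ≠ 0` — the END's bounded quantity is NOT zero -/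

/-- The dressed table reads `sW` at the polymer's domain (linearity of the read-out, `VppCLMM` BY NAME, and `(VppM_tabW_Z₀ D)`). [folklore] -/
theorem VppM_dressed_Z₀ : (PW D).VppM ((0 : B13HistM (PW D)) + (wW D)) (Z₀ D) (fun _ => (0 : ℝ)) = (sW : ℂ) := by
  rw [zero_add, wW, ← VppCLMM_apply, map_smul, VppCLMM_apply, VppM_tabW_Z₀, smul_eq_mul, mul_one]
/-- The undressed table reads `0`. [folklore] -/
theorem VppM_zero_Z₀ : (PW D).VppM (0 : B13HistM (PW D)) (Z₀ D) (fun _ => (0 : ℝ)) = 0 := by rw [← VppCLMM_apply, map_zero]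
/-- **THE DRESSED SLOT ACTIVITY AT `X₀` IN CLOSED FORM**: `e^{sW} − 1`. [folklore] -/
theorem actSW_dressed : (actSW D) N ((0 : B13HistM (PW D)) + (wW D)) (X₀ N) = ((Real.exp sW - 1 : ℝ) : ℂ) := by
  unfold actSW; rw [termsW_X₀, Finset.sum_singleton, actOfLetters_zero_closed, VppM_dressed_Z₀]; push_cast; rfl
/-- THE UNDRESSED SLOT ACTIVITY VANISHES (`F 1 − F 0` of a constant `F`). [folklore] -/
theorem actSW_undressed : (actSW D) N (0 : B13HistM (PW D)) (X₀ N) = 0 := by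
  unfold actSW; rw [termsW_X₀, Finset.sum_singleton, actOfLetters_zero_closed, VppM_zero_Z₀, Complex.exp_zero, sub_self]
/-- `0 < e^{sW} − 1 < 1` (`0 < sW ≤ 1/64`). [folklore] -/
theorem dressed_value_pos_lt_one : 0 < Real.exp sW - 1 ∧ Real.exp sW - 1 < 1 := by
  refine ⟨by linarith [Real.add_one_lt_exp sW_pos.ne', sW_pos], ?_⟩
  have h := Real.abs_exp_sub_one_le (x := sW) (by rw [abs_of_pos sW_pos]; linarith [sW_le])
  rw [abs_of_pos sW_pos] at h
  linarith [(abs_le.1 h).2, sW_le]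
/-- **THE ATTACHED PART IS NOT ZERO** — the Gaussian letters of record, the contour and the table are all LIVE. [folklore] -/
theorem actSW_live : (actSW D) N ((0 : B13HistM (PW D)) + (wW D)) (X₀ N) ≠ (actSW D) N 0 (X₀ N) := by
  rw [actSW_dressed, actSW_undressed, Ne, Complex.ofReal_eq_zero]; exact dressed_value_pos_lt_one.1.ne'
/-- Both pencil ends are STRICTLY inside the unit disc (so W24's `exp_locE_cube` applies). [folklore] -/
theorem norm_actSW_lt_one :
    ‖(actSW D) N ((0 : B13HistM (PW D)) + (wW D)) (X₀ N)‖ < 1 ∧ ‖(actSW D) N (0 : B13HistM (PW D)) (X₀ N)‖ < 1 := by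
  refine ⟨?_, by rw [actSW_undressed, norm_zero]; exact one_pos⟩
  rw [actSW_dressed, Complex.norm_real, Real.norm_eq_abs, abs_of_pos dressed_value_pos_lt_one.1]
  exact dressed_value_pos_lt_one.2

open Classical in
/-- **THE BOUNDED QUANTITY OF THE END IS NOT ZERO** [decided toy]: the dressed small-field outputs of the slot activities at the dressed
table `0 + (wW D)` and at the undressed table `0` DIFFER on the cube — W24's `exp_locE_cube` BY NAME turns equal outputs into equal
activities at `X₀`, contradicting `(actSW_live D)`. [folklore] -/
theorem slotLettersEnd_live :
    locE (Dom := (tsys 4 N).Dom) (TTouch (d := 4) (N := N)) (fun Z : (tsys 4 N).Dom => Z.1) ((actSW D) N ((0 : B13HistM (PW D)) + (wW D))) (X₀ N).1 ≠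
      locE (Dom := (tsys 4 N).Dom) (TTouch (d := 4) (N := N)) (fun Z : (tsys 4 N).Dom => Z.1) ((actSW D) N 0) (X₀ N).1 := by
  intro h
  have h1 : cexp (locE (Dom := (tsys 4 N).Dom) (TTouch (d := 4) (N := N)) (fun Z : (tsys 4 N).Dom => Z.1)
      ((actSW D) N ((0 : B13HistM (PW D)) + (wW D))) (X₀ N).1) = 1 + (actSW D) N ((0 : B13HistM (PW D)) + (wW D)) (X₀ N) :=
    exp_locE_cube N (w := (actSW D) N ((0 : B13HistM (PW D)) + (wW D))) ((norm_actSW_lt_one D) N).1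
  have h0 : cexp (locE (Dom := (tsys 4 N).Dom) (TTouch (d := 4) (N := N)) (fun Z : (tsys 4 N).Dom => Z.1)
      ((actSW D) N 0) (X₀ N).1) = 1 + (actSW D) N 0 (X₀ N) :=
    exp_locE_cube N (w := (actSW D) N 0) ((norm_actSW_lt_one D) N).2
  have h' := congrArg cexp h
  rw [h1, h0, add_right_inj] at h'
  exact (actSW_live D) N h'

end Torus

/-! ## §7 THE SCHEMA's PARAMETERS ARE INHABITED HYPOTHESIS-FREE: the substrate's driven two-run object of record at `SU(2)` on the
sanity family `F13`, and the driven run-B background of the unit field (`1 ∈ domV`, `one_mem_domV_drivenRecordSU` BY NAME) -/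

/-- THE DRIVEN TWO-RUN OBJECT OF RECORD at `SU(2)` (substrate p2's `drivenRecordSU`, HYPOTHESIS-FREE) on `T4WindowLevelShift.Sanity.F13`
(`L = 13`, `m = 1`), `K = 0`, cube exponent `0`, unit couplings (toy choice of the free letters). [folklore] -/
def DW : DrivenRuns (Matrix.specialUnitaryGroup (Fin 2) ℂ) := drivenRecordSU (n := Fin 2) F13 0 0 (fun _ => 1) (fun _ => 1)
/-- A run-B background of its carriers: the driven background `U^B_{K+1}(1)` of the unit field. [folklore] -/
def UW : DW.carriers.BgB := DW.uB ⟨1, one_mem_domV_drivenRecordSU (n := Fin 2) F13 0 0 (fun _ => 1) (fun _ => 1)⟩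

open Classical in
/-- **THE SLOT-LETTERS END FIRES ON THE TORUS OVER THE DRIVEN RUNS OF RECORD AT `SU(2)`** (§5 at `D := DW`, `U := UW`). [folklore] -/
theorem slotLettersEnd_fires_torus_SU2 (N : ℕ) [NeZero N] (k : ℕ) :
    ‖locE (Dom := (tsys 4 N).Dom) (TTouch (d := 4) (N := N)) (fun Z : (tsys 4 N).Dom => Z.1) (actSW DW N ((0 : B13HistM (PW DW)) + wW DW))
          (X₀ N).1 -
        locE (Dom := (tsys 4 N).Dom) (TTouch (d := 4) (N := N)) (fun Z : (tsys 4 N).Dom => Z.1) (actSW DW N 0) (X₀ N).1‖ ≤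
      4 * (Real.exp 1 * 9 * 64 * K₀ 64 8 ^ 2) * (Acst / 2) * Real.exp (-(0 * torusTreeLen (X₀ N).1)) :=
  slotLettersEnd_fires_torus DW N UW k

open Classical in
/-- … and its bounded quantity is NOT zero there. [folklore] -/
theorem slotLettersEnd_live_SU2 (N : ℕ) [NeZero N] :
    locE (Dom := (tsys 4 N).Dom) (TTouch (d := 4) (N := N)) (fun Z : (tsys 4 N).Dom => Z.1) (actSW DW N ((0 : B13HistM (PW DW)) + wW DW))
        (X₀ N).1 ≠
      locE (Dom := (tsys 4 N).Dom) (TTouch (d := 4) (N := N)) (fun Z : (tsys 4 N).Dom => Z.1) (actSW DW N 0) (X₀ N).1 :=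
  slotLettersEnd_live DW N

end Summit.QuantumFields.BalabanUV.T4Continuum.NE1p.DressedSmallFieldSlotLettersWitnessEnd
end
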